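import Literature.Topology.FourManifolds.CappellShanesonCover
import Literature.Topology.FourManifolds.ThreeTorusOrientation
import Literature.Topology.FourManifolds.SpecialLinearPath
import Literature.AlgebraicTopology.SingularHomology.FundamentalClassProofs
import HarnessLib

/-!
# Linear torus maps preserve the orientation and the fundamental class of `T³`

Second step (after `ThreeTorusHomologyOne.lean`) of the discharge of the torus input
`Literature.Topology.FourManifolds.singularHomology_threeTorus_linear` of the Cappell–Shaneson
decomposition (`CappellShanesonWang.lean`; S. E. Cappell, J. L. Shaneson, *Some new
four-manifolds*, Ann. of Math. 104 (1976), §2; A. Hatcher, *Algebraic Topology* (2002), §3.C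
Exercise 11). The `H₂` half of that fact is the Poincaré dual of the `H₁` half, and the duality
isomorphism `a ↦ a ⌢ [T³]` commutes with `(torusMap A)_*` exactly when `torusMap A` fixes the
fundamental class. This file **proves** that it does, for every `A ∈ SL(3, ℤ)`:

* `Literature.Topology.FourManifolds.relativeSingularHomology_map_mulVecEC_eq_id`: a real matrix
  joined to `1` by a path of invertible matrices (`Literature.Topology.FourManifolds.SmoothMatrixPath`,
  `SpecialLinearPath.lean`; every matrix of determinant `1`) acts as the **identity on the local
  homology `Hₖ(ℝ³ | 0)`** — the path is a homotopy of maps of pairs `(ℝ³, ℝ³ ∖ 0) → (ℝ³, ℝ³ ∖ 0)`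
  (Hatcher Prop. 2.19, proved in the tree: `relativeSingularHomology.map_eq_of_homotopic_holds`).
* `Literature.Topology.FourManifolds.ThreeTorus.isIso_map_expTOn`: the exponential coordinates
  `expT : (W, W ∖ 0) → (T³, T³ ∖ 1)` on an open `W ⊆ (-π, π)³` induce **isomorphisms on local
  homology** (a homeomorphism onto an open set followed by excision, Hatcher §3.3 p. 231 /
  Thm. 2.20, proved in the tree: `localHomology.openSubsetIso`).
* `Literature.Topology.FourManifolds.ThreeTorus.relativeSingularHomology_map_torusMapC_eq_id`:
  **`torusMap A` is the identity on `Hₖ(T³ | 1)`** for `A ∈ SL(3, ℤ)` — in exponential coordinates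
  it is the linear map `A` (`torusMap_expT`), which is the identity on `Hₖ(ℝ³ | 0)`.
* `Literature.Topology.FourManifolds.ThreeTorus.comap_homologicalOrientation_monodromyHomeo`:
  the left-invariant `ℤ`-orientation of `T³` (`ThreeTorus.homologicalOrientation`,
  `ThreeTorusOrientation.lean`) is **preserved by `torusMap A`** (two orientations of the connected
  manifold `T³` agreeing at the point `1` are equal, Hatcher §3.3 pp. 234–235, proved in the tree:
  `HomologicalOrientation.ext_of_connected_holds`).
* **`Literature.Topology.FourManifolds.ThreeTorus.map_torusMapC_fundamentalClass`**:
  `(torusMap A)_* [T³] = [T³]` in `H₃(T³; ℤ)` for every `A ∈ SL(3, ℤ)` (naturality of the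
  fundamental class under homeomorphisms, Hatcher §3.3 p. 236, proved in the tree:
  `HomologicalOrientation.fundamentalClass_comap_holds`). Informally: `torusMap A` has degree
  `det A = 1` (Hatcher §3.C Exercise 11: `A` acts on `H₃(T³) = Λ³ℤ³` by `det A`).

Everything here is proved; the new data are the auxiliary continuous maps and one homeomorphism
(`ThreeTorus.expTHomeomorph`).

## References

* A. Hatcher, *Algebraic Topology*, CUP 2002, §2.1 Prop. 2.19, Thm. 2.20; §3.3 pp. 231–236;
  §3.C Exercise 11 [HatcherAT2002].
* S. E. Cappell, J. L. Shaneson, *Some new four-manifolds*, Ann. of Math. 104 (1976) 61–72, §2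
  [CappellShanesonAnnals1976].
-/

noncomputable section

open Set Function CategoryTheory Limits Topology
open scoped unitInterval Real
open Literature.AlgebraicTopology.SingularHomology

namespace Literature.Topology.FourManifolds

universe u v

/-- Local notation: `𝔼 n` is the model Euclidean space `EuclideanSpace ℝ (Fin n)`. -/
local notation "𝔼 " n:arg => EuclideanSpace ℝ (Fin n)

/-- Equal maps of pairs induce equal maps on relative homology (congruence in the map, for any
two proofs of the subspace condition). [folklore] -/
theorem relativeSingularHomology_map_congr {R' : Type v} [CommRing R'] {M' : Type v} [AddCommGroup M']
    [Module R' M'] {X Y : Type u} [TopologicalSpace X] [TopologicalSpace Y] {S : Set X} {T : Set Y}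
    {f f' : C(X, Y)} (e : f = f') (h : MapsTo f S T) (h' : MapsTo f' S T) (n : ℕ) :
    relativeSingularHomology.map R' M' f h n = relativeSingularHomology.map R' M' f' h' n := by
  subst e; rfl

variable (R : Type) [CommRing R] (V : Type) [AddCommGroup V] [Module R V]

/-! ### Invertible linear maps joined to `1` act trivially on `Hₖ(ℝ³ | 0)` -/

section Linear

/-- The linear self-map `v ↦ M v` of `ℝ³` as a continuous map. [folklore] -/
def mulVecEC (M : Matrix (Fin 3) (Fin 3) ℝ) : C(𝔼 3, 𝔼 3) :=
  ⟨mulVecE M, CappellShaneson.continuous_mulVecE M⟩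

/-- Values of `mulVecEC`. [folklore] -/
@[simp] theorem mulVecEC_apply (M : Matrix (Fin 3) (Fin 3) ℝ) (v : 𝔼 3) :
    mulVecEC M v = mulVecE M v := rfl

/-- Along a path of invertible matrices, `γ(θ) v ≠ 0` for `v ≠ 0`. [folklore] -/
theorem SmoothMatrixPath.mulVecE_ne_zero {M : Matrix (Fin 3) (Fin 3) ℝ} (γ : SmoothMatrixPath M)
    (θ : ℝ) {v : 𝔼 3} (hv : v ≠ 0) : mulVecE (γ.toFun θ) v ≠ 0 := by
  intro h
  apply hv
  have e : mulVecE (γ.inv θ) (mulVecE (γ.toFun θ) v) = v := by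
    rw [mulVecE_mulVecE, γ.inv_mul, mulVecE_one]
  rw [← e, h, mulVecE_zero]

/-- A matrix joined to `1` by a path of invertible matrices maps `ℝ³ ∖ 0` to itself. [folklore] -/
theorem SmoothMatrixPath.mapsTo_mulVecEC {M : Matrix (Fin 3) (Fin 3) ℝ} (γ : SmoothMatrixPath M) :
    MapsTo (mulVecEC M) ({0}ᶜ : Set (𝔼 3)) {0}ᶜ := by
  intro v hv
  have h := γ.mulVecE_ne_zero 1 (v := v) hv
  rwa [γ.eq_self 1 le_rfl] at h

/-- The path `θ ↦ γ(θ)` as a homotopy from the identity to `v ↦ M v`. [folklore] -/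
def SmoothMatrixPath.homotopy {M : Matrix (Fin 3) (Fin 3) ℝ} (γ : SmoothMatrixPath M) :
    ContinuousMap.Homotopy (ContinuousMap.id (𝔼 3)) (mulVecEC M) where
  toFun p := mulVecE (γ.toFun p.1) p.2
  continuous_toFun :=
    (contDiff_mulVecE (M := γ.toFun) γ.contDiff_apply).continuous.comp
      ((continuous_subtype_val.comp continuous_fst).prodMk continuous_snd)
  map_zero_left v := by
    change mulVecE (γ.toFun 0) v = v
    rw [γ.eq_one 0 le_rfl, mulVecE_one]
  map_one_left v := by
    change mulVecE (γ.toFun 1) v = mulVecE M v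
    rw [γ.eq_self 1 le_rfl]

/-- **An invertible linear map in the path component of `1` is the identity on local homology
`Hₖ(ℝ³ | 0)`**: the path is a homotopy of maps of pairs `(ℝ³, ℝ³ ∖ 0) → (ℝ³, ℝ³ ∖ 0)` from `id` to
`v ↦ M v` (Hatcher 2002, Prop. 2.19; here for matrices with a `SmoothMatrixPath`, e.g. every
matrix of determinant `1`, `nonempty_smoothMatrixPath_of_det_eq_one`). [cite: HatcherAT2002, Prop. 2.19] -/
theorem relativeSingularHomology_map_mulVecEC_eq_id {M : Matrix (Fin 3) (Fin 3) ℝ}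
    (γ : SmoothMatrixPath M) (h : MapsTo (mulVecEC M) ({0}ᶜ : Set (𝔼 3)) {0}ᶜ) (k : ℕ) :
    relativeSingularHomology.map R V (mulVecEC M) h k = 𝟙 (localHomology R V (𝔼 3) 0 k) := by
  have hF : ∀ p : I × 𝔼 3, p.2 ∈ ({0}ᶜ : Set (𝔼 3)) → γ.homotopy p ∈ ({0}ᶜ : Set (𝔼 3)) :=
    fun p hp ↦ mem_compl_singleton_iff.2 (γ.mulVecE_ne_zero p.1 (mem_compl_singleton_iff.1 hp))
  rw [← relativeSingularHomology.map_eq_of_homotopic_holds R V (mapsTo_id _) h γ.homotopy hF k,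
    relativeSingularHomology.map_id]

end Linear

/-! ### Exponential coordinates induce isomorphisms on local homology -/

namespace ThreeTorus

/-- The open cube `(-π, π)³ ⊆ ℝ³`, on which `expT` is injective. [folklore] -/
def logCube : Set (𝔼 3) := {v | ∀ j, |v j| < π}

/-- `0 ∈ (-π, π)³`. [folklore] -/
theorem zero_mem_logCube : (0 : 𝔼 3) ∈ logCube := fun j ↦ by
  simp [Real.pi_pos]

/-- `(-π, π)³` is open. [folklore] -/
theorem isOpen_logCube : IsOpen logCube := by
  have h : logCube = ⋂ j, (fun v : 𝔼 3 ↦ |v j|) ⁻¹' Iio π := by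
    ext v; simp [logCube]
  rw [h]
  exact isOpen_iInter_of_finite fun j ↦
    (continuous_abs.comp (EuclideanSpace.proj (𝕜 := ℝ) j).continuous).isOpen_preimage _ isOpen_Iio

/-- `expT` is injective on `(-π, π)³`. [folklore] -/
theorem expT_injOn_logCube : InjOn expT logCube := fun _ hv _ hw h ↦
  expT_injOn (fun j ↦ ⟨(abs_lt.1 (hv j)).1, (abs_lt.1 (hv j)).2.le⟩)
    (fun j ↦ ⟨(abs_lt.1 (hw j)).1, (abs_lt.1 (hw j)).2.le⟩) h

variable {W : Set (𝔼 3)}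

/-- `expT` restricted to a subset `W ⊆ ℝ³`, as a continuous map `W → T³`. [folklore] -/
def expTOn (W : Set (𝔼 3)) : C(↥W, ThreeTorus) :=
  ⟨fun v ↦ expT v.1, continuous_expT.comp continuous_subtype_val⟩

/-- Values of `expTOn`. [folklore] -/
@[simp] theorem expTOn_apply (v : ↥W) : expTOn W v = expT v.1 := rfl

/-- On `W ⊆ (-π, π)³`, `expT` sends `W ∖ 0` into `T³ ∖ expT 0`. [folklore] -/
theorem mapsTo_expTOn (hW : W ⊆ logCube) (h0 : (0 : 𝔼 3) ∈ W) :
    MapsTo (expTOn W) ({(⟨0, h0⟩ : ↥W)}ᶜ : Set ↥W) ({expT 0}ᶜ : Set ThreeTorus) := by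
  intro v hv h
  apply hv
  rw [mem_singleton_iff]
  exact Subtype.ext (expT_injOn_logCube (hW v.2) (hW h0) h)

/-- **`expT` is a homeomorphism from an open `W ⊆ (-π, π)³` onto its (open) image**, with inverse
the principal logarithms `logT` (`logT_expT_of_abs_lt`, `contMDiffOn_logT`). [folklore] -/
def expTHomeomorph (hW : W ⊆ logCube) : ↥W ≃ₜ ↥(expT '' W) where
  toFun v := ⟨expT v.1, mem_image_of_mem _ v.2⟩
  invFun z := ⟨logT z.1, by
    obtain ⟨v, hv, hz⟩ := z.2
    rw [← hz, logT_expT_of_abs_lt (hW hv)]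
    exact hv⟩
  left_inv v := Subtype.ext (logT_expT_of_abs_lt (hW v.2))
  right_inv z := Subtype.ext (expT_logT z.1)
  continuous_toFun := (continuous_expT.comp continuous_subtype_val).subtype_mk _
  continuous_invFun := by
    have hsub : ∀ z : ↥(expT '' W), z.1 ∈ torusSlit := by
      rintro ⟨_, v, hv, rfl⟩
      exact expT_mem_torusSlit (hW hv)
    exact (contMDiffOn_logT.continuousOn.comp_continuous continuous_subtype_val hsub).subtype_mk _

/-- `expT|_W` is the homeomorphism onto its image followed by the inclusion. [folklore] -/
theorem subsetIncl_comp_expTHomeomorph (hW : W ⊆ logCube) :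
    (subsetIncl (expT '' W)).comp (expTHomeomorph hW : C(↥W, ↥(expT '' W))) = expTOn W := by
  ext v : 1
  rfl

/-- **`expT : (W, W ∖ 0) → (T³, T³ ∖ expT 0)` is an isomorphism on local homology** for `W` open
in `(-π, π)³` (Hatcher 2002, §3.3 p. 231: local homology depends only on a neighbourhood; the map
factors as a homeomorphism onto the open set `expT(W)` followed by the excision isomorphism
`localHomology.openSubsetIso`). [cite: HatcherAT2002, §3.3 p. 231] -/
theorem isIso_map_expTOn (hWo : IsOpen W) (hW : W ⊆ logCube) (h0 : (0 : 𝔼 3) ∈ W) (k : ℕ) :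
    IsIso (relativeSingularHomology.map R V (expTOn W) (mapsTo_expTOn hW h0) k) := by
  have hO : IsOpen (expT '' W) := CappellShaneson.isOpenMap_expT _ hWo
  let e := expTHomeomorph hW
  have key : relativeSingularHomology.map R V (expTOn W) (mapsTo_expTOn hW h0) k =
      (localHomology.mapIso R V e ⟨0, h0⟩ k ≪≫
        localHomology.openSubsetIso R V hO (e ⟨0, h0⟩).2 k).hom := by
    change _ = relativeSingularHomology.map R V _ _ k ≫ relativeSingularHomology.map R V _ _ k
    rw [← relativeSingularHomology.map_comp]
    exact relativeSingularHomology.map.congr_simp R V _ _ (subsetIncl_comp_expTHomeomorph hW).symm _ k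
  rw [key]
  exact Iso.isIso_hom _

/-! ### `torusMap A` is the identity on `Hₖ(T³ | 1)` -/

variable (A : Matrix.SpecialLinearGroup (Fin 3) ℤ)

/-- The linear map `v ↦ A v` restricted to `W' := W ∩ A⁻¹ W → W`. [folklore] -/
def mulVecOn (W : Set (𝔼 3)) : C(↥(W ∩ mulVecEC (slRealMatrix A) ⁻¹' W), ↥W) :=
  ⟨fun v ↦ ⟨mulVecE (slRealMatrix A) v.1, v.2.2⟩,
    ((CappellShaneson.continuous_mulVecE _).comp continuous_subtype_val).subtype_mk _⟩

/-- `0 ∈ W ∩ A⁻¹ W` when `0 ∈ W`. [folklore] -/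
theorem zero_mem_inter_preimage (h0 : (0 : 𝔼 3) ∈ W) :
    (0 : 𝔼 3) ∈ W ∩ mulVecEC (slRealMatrix A) ⁻¹' W :=
  ⟨h0, by rw [mem_preimage, mulVecEC_apply, mulVecE_zero]; exact h0⟩

/-- **Equivariance in exponential coordinates, as maps of pairs**:
`torusMap A ∘ expT|_{W'} = expT|_W ∘ A|_{W'}` (`torusMap_expT`). [folklore] -/
theorem torusMapC_comp_expTOn (W : Set (𝔼 3)) :
    (torusMapC A).comp (expTOn (W ∩ mulVecEC (slRealMatrix A) ⁻¹' W)) =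
      (expTOn W).comp (mulVecOn A W) := by
  ext v : 1
  exact torusMap_expT A.1 v.1

/-- `incl_W ∘ A|_{W'} = A ∘ incl_{W'}` as maps into `ℝ³`. [folklore] -/
theorem subsetIncl_comp_mulVecOn (W : Set (𝔼 3)) :
    (subsetIncl W).comp (mulVecOn A W) =
      (mulVecEC (slRealMatrix A)).comp (subsetIncl (W ∩ mulVecEC (slRealMatrix A) ⁻¹' W)) := by
  ext v : 1
  rfl

/-- **`torusMap A` is the identity on the local homology `Hₖ(T³ | expT 0)`**, `A ∈ SL(3, ℤ)`: in
the exponential chart it is the linear map `A` (`torusMap_expT`), the chart maps are isomorphisms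
on local homology (`isIso_map_expTOn`), and `A` is the identity on `Hₖ(ℝ³ | 0)`
(`relativeSingularHomology_map_mulVecEC_eq_id`, via a path from `1` to `A` in `SL(3, ℝ)`,
`nonempty_smoothMatrixPath_specialLinearGroup`) (Hatcher 2002, §3.C Exercise 11: `A` acts on the
top homology of the torus by `det A = 1`; Prop. 2.19, §3.3 p. 231). [cite: HatcherAT2002, §3.C Exercise 11] -/
theorem relativeSingularHomology_map_torusMapC_eq_id_expT
    (h : MapsTo (torusMapC A) ({expT 0}ᶜ : Set ThreeTorus) {expT 0}ᶜ) (k : ℕ) :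
    relativeSingularHomology.map R V (torusMapC A) h k = 𝟙 _ := by
  obtain ⟨γ⟩ := nonempty_smoothMatrixPath_specialLinearGroup A
  -- the two open sets `D = (-π, π)³` and `D' = D ∩ A⁻¹ D`
  have hDo : IsOpen logCube := isOpen_logCube
  have hD'o : IsOpen (logCube ∩ (mulVecEC (slRealMatrix A)) ⁻¹' logCube) := hDo.inter (hDo.preimage (mulVecEC (slRealMatrix A)).continuous)
  have h0' : (0 : 𝔼 3) ∈ logCube ∩ (mulVecEC (slRealMatrix A)) ⁻¹' logCube := zero_mem_inter_preimage A zero_mem_logCube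
  have hD'sub : logCube ∩ (mulVecEC (slRealMatrix A)) ⁻¹' logCube ⊆ logCube := inter_subset_left
  -- the maps of pairs and their `MapsTo` conditions
  have hLm : MapsTo (mulVecEC (slRealMatrix A)) ({0}ᶜ : Set (𝔼 3)) {0}ᶜ := γ.mapsTo_mulVecEC
  have hL'm : MapsTo (mulVecOn A logCube) ({(⟨0, h0'⟩ : ↥(logCube ∩ (mulVecEC (slRealMatrix A)) ⁻¹' logCube))}ᶜ : Set _)
      ({(⟨0, zero_mem_logCube⟩ : ↥logCube)}ᶜ : Set ↥logCube) := by
    intro v hv hv0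
    apply hv
    rw [mem_singleton_iff] at hv0 ⊢
    have h1 : mulVecE (slRealMatrix A) v.1 = 0 := congrArg Subtype.val hv0
    have h2 : (v.1 : 𝔼 3) = 0 := by
      by_contra hne
      exact hLm hne h1
    exact Subtype.ext h2
  have hιm : MapsTo (subsetInclusion hD'sub) ({(⟨0, h0'⟩ : ↥(logCube ∩ (mulVecEC (slRealMatrix A)) ⁻¹' logCube))}ᶜ : Set _)
      ({(⟨0, zero_mem_logCube⟩ : ↥logCube)}ᶜ : Set ↥logCube) := by
    intro v hv hv0
    apply hv
    rw [mem_singleton_iff] at hv0 ⊢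
    have h1 : (v.1 : 𝔼 3) = 0 := congrArg Subtype.val hv0
    exact Subtype.ext h1
  -- (2): `A|_{D'} ≫ incl_D = incl_{D'} ≫ A = incl_{D'}` on local homology, hence `A|_{D'} = ι`
  have hI : MapsTo (subsetIncl logCube) ({(⟨0, zero_mem_logCube⟩ : ↥logCube)}ᶜ : Set ↥logCube)
      ({0}ᶜ : Set (𝔼 3)) := localHomology.mapsTo_subsetIncl_compl zero_mem_logCube
  have hI' : MapsTo (subsetIncl (logCube ∩ (mulVecEC (slRealMatrix A)) ⁻¹' logCube))
      ({(⟨0, h0'⟩ : ↥(logCube ∩ (mulVecEC (slRealMatrix A)) ⁻¹' logCube))}ᶜ : Set _) ({0}ᶜ : Set (𝔼 3)) :=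
    localHomology.mapsTo_subsetIncl_compl h0'
  have h2 : relativeSingularHomology.map R V (mulVecOn A logCube) hL'm k ≫
      relativeSingularHomology.map R V (subsetIncl logCube) hI k =
      relativeSingularHomology.map R V (subsetInclusion hD'sub) hιm k ≫
        relativeSingularHomology.map R V (subsetIncl logCube) hI k :=
    calc relativeSingularHomology.map R V (mulVecOn A logCube) hL'm k ≫
          relativeSingularHomology.map R V (subsetIncl logCube) hI k
        = relativeSingularHomology.map R V ((subsetIncl logCube).comp (mulVecOn A logCube))
            (hI.comp hL'm) k := (relativeSingularHomology.map_comp R V _ _ hL'm hI k).symm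
      _ = relativeSingularHomology.map R V ((mulVecEC (slRealMatrix A)).comp (subsetIncl (logCube ∩ (mulVecEC (slRealMatrix A)) ⁻¹' logCube)))
            (hLm.comp hI') k :=
          relativeSingularHomology_map_congr (subsetIncl_comp_mulVecOn A logCube) _ _ k
      _ = relativeSingularHomology.map R V (subsetIncl (logCube ∩ (mulVecEC (slRealMatrix A)) ⁻¹' logCube)) hI' k ≫
            relativeSingularHomology.map R V (mulVecEC (slRealMatrix A)) hLm k :=
          relativeSingularHomology.map_comp R V _ _ hI' hLm k
      _ = relativeSingularHomology.map R V (subsetIncl (logCube ∩ (mulVecEC (slRealMatrix A)) ⁻¹' logCube)) hI' k := by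
          rw [relativeSingularHomology_map_mulVecEC_eq_id R V γ, Category.comp_id]
      _ = relativeSingularHomology.map R V ((subsetIncl logCube).comp (subsetInclusion hD'sub))
            (hI.comp hιm) k := relativeSingularHomology_map_congr rfl _ _ k
      _ = relativeSingularHomology.map R V (subsetInclusion hD'sub) hιm k ≫
            relativeSingularHomology.map R V (subsetIncl logCube) hI k :=
          relativeSingularHomology.map_comp R V _ _ hιm hI k
  haveI : IsIso (relativeSingularHomology.map R V (subsetIncl logCube) hI k) :=
    localHomology.isIso_map_subsetIncl_of_isOpen R V hDo zero_mem_logCube k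
  have h2' : relativeSingularHomology.map R V (mulVecOn A logCube) hL'm k =
      relativeSingularHomology.map R V (subsetInclusion hD'sub) hιm k :=
    (cancel_mono _).1 h2
  -- (1): `expT|_{D'} ≫ torusMap A = A|_{D'} ≫ expT|_D = ι ≫ expT|_D = expT|_{D'}`
  have hE : MapsTo (expTOn logCube) ({(⟨0, zero_mem_logCube⟩ : ↥logCube)}ᶜ : Set ↥logCube)
      ({expT 0}ᶜ : Set ThreeTorus) := mapsTo_expTOn subset_rfl zero_mem_logCube
  have hE' : MapsTo (expTOn (logCube ∩ (mulVecEC (slRealMatrix A)) ⁻¹' logCube))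
      ({(⟨0, h0'⟩ : ↥(logCube ∩ (mulVecEC (slRealMatrix A)) ⁻¹' logCube))}ᶜ : Set _) ({expT 0}ᶜ : Set ThreeTorus) :=
    mapsTo_expTOn hD'sub h0'
  have h1 : relativeSingularHomology.map R V (expTOn (logCube ∩ (mulVecEC (slRealMatrix A)) ⁻¹' logCube)) hE' k ≫
      relativeSingularHomology.map R V (torusMapC A) h k =
      relativeSingularHomology.map R V (expTOn (logCube ∩ (mulVecEC (slRealMatrix A)) ⁻¹' logCube)) hE' k :=
    calc relativeSingularHomology.map R V (expTOn (logCube ∩ (mulVecEC (slRealMatrix A)) ⁻¹' logCube)) hE' k ≫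
          relativeSingularHomology.map R V (torusMapC A) h k
        = relativeSingularHomology.map R V ((torusMapC A).comp (expTOn (logCube ∩ (mulVecEC (slRealMatrix A)) ⁻¹' logCube)))
            (h.comp hE') k := (relativeSingularHomology.map_comp R V _ _ hE' h k).symm
      _ = relativeSingularHomology.map R V ((expTOn logCube).comp (mulVecOn A logCube))
            (hE.comp hL'm) k :=
          relativeSingularHomology_map_congr (torusMapC_comp_expTOn A logCube) _ _ k
      _ = relativeSingularHomology.map R V (mulVecOn A logCube) hL'm k ≫
            relativeSingularHomology.map R V (expTOn logCube) hE k :=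
          relativeSingularHomology.map_comp R V _ _ hL'm hE k
      _ = relativeSingularHomology.map R V (subsetInclusion hD'sub) hιm k ≫
            relativeSingularHomology.map R V (expTOn logCube) hE k := by rw [h2']
      _ = relativeSingularHomology.map R V ((expTOn logCube).comp (subsetInclusion hD'sub))
            (hE.comp hιm) k := (relativeSingularHomology.map_comp R V _ _ hιm hE k).symm
      _ = relativeSingularHomology.map R V (expTOn (logCube ∩ (mulVecEC (slRealMatrix A)) ⁻¹' logCube)) hE' k :=
          relativeSingularHomology_map_congr rfl _ _ k
  haveI : IsIso (relativeSingularHomology.map R V (expTOn (logCube ∩ (mulVecEC (slRealMatrix A)) ⁻¹' logCube)) hE' k) :=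
    isIso_map_expTOn R V hD'o hD'sub h0' k
  rw [← cancel_epi (relativeSingularHomology.map R V (expTOn (logCube ∩ (mulVecEC (slRealMatrix A)) ⁻¹' logCube)) hE' k), h1,
    Category.comp_id]

/-- **`torusMap A` is the identity on `Hₖ(T³ | 1)`** for `A ∈ SL(3, ℤ)` (the previous statement at
the base point `1 = expT 0`; stated for any `p = expT 0` to absorb the rewriting). [cite: HatcherAT2002, §3.C Exercise 11] -/
theorem relativeSingularHomology_map_torusMapC_eq_id {p : ThreeTorus} (hp : p = expT 0)
    (h : MapsTo (torusMapC A) ({p}ᶜ : Set ThreeTorus) {p}ᶜ) (k : ℕ) :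
    relativeSingularHomology.map R V (torusMapC A) h k = 𝟙 _ := by
  subst hp
  exact relativeSingularHomology_map_torusMapC_eq_id_expT R V A h k

/-! ### The orientation and the fundamental class are preserved -/

/-- `torusMap A` fixes the local generator `μ₁ ∈ H₃(T³ | 1; ℤ)` (it is the identity there).
[folklore] -/
theorem map_torusMapC_localGen {y : ThreeTorus} (hy : y = 1)
    (h : MapsTo (torusMapC A) ({y}ᶜ : Set ThreeTorus) {1}ᶜ) :
    relativeSingularHomology.map ℤ ℤ (torusMapC A) h 3 (localGen y) = localGen 1 := by
  subst hy
  rw [relativeSingularHomology_map_torusMapC_eq_id ℤ ℤ A expT_zero.symm h 3, ModuleCat.id_apply]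

/-- The inverse of the torus homeomorphism of `A` is the torus map of `A⁻¹`, as a continuous map.
[folklore] -/
theorem coe_monodromyHomeo_symm :
    ((CappellShaneson.monodromyHomeo A).symm : C(ThreeTorus, ThreeTorus)) = torusMapC A⁻¹ := by
  ext z : 1
  exact CappellShaneson.torusDiffeomorph_symm_apply A z

/-- The torus homeomorphism of `A⁻¹`, inverted, is the torus map of `A`, as a continuous map.
[folklore] -/
theorem coe_monodromyHomeo_inv_symm :
    ((CappellShaneson.monodromyHomeo A⁻¹).symm : C(ThreeTorus, ThreeTorus)) = torusMapC A := by
  rw [coe_monodromyHomeo_symm, inv_inv]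

/-- **`torusMap A` preserves the left-invariant orientation of `T³`**: transporting
`ThreeTorus.homologicalOrientation` along the homeomorphism `torusMap A` gives it back — the two
orientations agree at `1` (`map_torusMapC_localGen`), and `T³` is connected (Hatcher 2002, §3.3,
pp. 234–235, uniqueness of orientations agreeing at a point, `ext_of_connected_holds`).
[cite: HatcherAT2002, §3.3 pp. 234–235] -/
theorem comap_homologicalOrientation_monodromyHomeo :
    homologicalOrientation.comap (CappellShaneson.monodromyHomeo A) = homologicalOrientation := by
  letI := threeTorusChartedSpaceFinThree
  refine HomologicalOrientation.ext_of_connected_holds ℤ ThreeTorus _ _ 1 ?_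
  rw [HomologicalOrientation.comap_localClass]
  change relativeSingularHomology.map ℤ ℤ
    ((CappellShaneson.monodromyHomeo A).symm : C(ThreeTorus, ThreeTorus)) _ 3
      (localGen (CappellShaneson.monodromyHomeo A 1)) = localGen 1
  have hy : CappellShaneson.monodromyHomeo A 1 = 1 := torusDiffeomorph_apply_one A
  have h' : MapsTo (torusMapC A⁻¹) ({CappellShaneson.monodromyHomeo A 1}ᶜ : Set ThreeTorus) {1}ᶜ := by
    rw [hy]
    intro z hz hz1
    apply hz
    rw [mem_singleton_iff] at hz1 ⊢
    have := congrArg (torusMap A.1) hz1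
    rwa [torusMap_apply_one, show torusMap A.1 ((torusMapC A⁻¹) z) = z from
      (torusDiffeomorph A).apply_symm_apply z] at this
  rw [relativeSingularHomology.map.congr_simp ℤ ℤ _ _ (coe_monodromyHomeo_symm A) _ 3]
  exact map_torusMapC_localGen A⁻¹ hy h'

/-- **`(torusMap A)_* [T³] = [T³]`**: the linear torus maps, `A ∈ SL(3, ℤ)`, fix the fundamental
class of `T³` (for the orientation `ThreeTorus.homologicalOrientation`). From the naturality of the
fundamental class under homeomorphisms (Hatcher 2002, §3.3 p. 236;
`HomologicalOrientation.fundamentalClass_comap_holds`) and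
`comap_homologicalOrientation_monodromyHomeo` for `A⁻¹`. (Hatcher §3.C Exercise 11: `A` acts on
`H₃(T³; ℤ) ≅ ℤ` by `det A = 1`.) [cite: HatcherAT2002, §3.C Exercise 11] -/
theorem map_torusMapC_fundamentalClass :
    singularHomology.map ℤ ℤ (torusMapC A) 3 homologicalOrientation.fundamentalClass =
      homologicalOrientation.fundamentalClass := by
  letI := threeTorusChartedSpaceFinThree
  have h := HomologicalOrientation.fundamentalClass_comap_holds ℤ ThreeTorus ThreeTorus 3
    homologicalOrientation (CappellShaneson.monodromyHomeo A⁻¹)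
  rw [comap_homologicalOrientation_monodromyHomeo] at h
  rw [singularHomology.mapIso_inv] at h
  rw [← coe_monodromyHomeo_inv_symm]
  exact h.symm

end ThreeTorus

end Literature.Topology.FourManifolds

end
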